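import Mathlib
import Literature.Analysis.FluidPDE.HardSphereCollisionRecord
import Literature.Analysis.FluidPDE.HardSphereTorusMeasure
import Literature.MathematicalPhysics.KineticTheory.HardSphereEuler
import Literature.MathematicalPhysics.KineticTheory.HardSphereEulerProofs
import Summits.AtomisticToContinuum.HydrodynamicLimit.Theorems.OneFlightGossipEngineOneFlightLayeredChaosCellBoundaryLayer
import HarnessLib

/-!
# `OneFlightGossipEngine.OneFlightLayeredChaos` — the free-volume brick: inserting one sphere among hard-core others
(crux stmt-AtomisticToContinuum-14535, line `Sketch`, lead c4 wave 2; registered stub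
`volume_posDomain_ge_othersDomain`)

A brick of the first-rung transfer `TwoDirectionGhostInput → FirstFlightGhostInput` of the crux: integrating
out the position `x i` of the tagged particle turns the `n`-particle hard-core law (uniform on the non-overlap
set `posDomain ε n`) into the hard-core law of the OTHER particles, up to the normalisation ratio
`Z_others / Z_n`.  This file bounds that ratio through the FREE VOLUME of one sphere among `n - 1` others:

`vol (posDomain ε n) ≥ (1 - (n - 1) (2ε)³) · vol {x | the particles other than i do not overlap at scale ε}`.

Proof (fibrewise free volume; the union bound of Bodineau–Gallagher–Saint-Raymond, Invent. Math. 203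
(2016), Appendix A, first step).  Split `x = (x i, x_{-i})` with the volume-preserving measurable equivalence
`MeasurableEquiv.piFinSuccAbove` (`volume_preserving_piFinSuccAbove`).  The event "the others do not
overlap" only constrains `x_{-i}`: it is contained in `univ ×ˢ posDomain ε (n - 1)`
(`othersDomain_subset_preimage_piFinSuccAbove`).  Over each `x_{-i} ∈ posDomain ε (n - 1)` the fibre of
`posDomain ε n` contains the free volume `{p | ∀ k, ε ≤ dist (p, x_k)}` (`insertNth_mem_posDomain`), the
complement of `n - 1` balls of the minimal-image distance, each of Haar probability `≤ (2ε)³` (such a ball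
lies in a sup-metric ball, the product of three arcs of length `min 1 (2ε)`: `AddCircle.volume_closedBall`,
`Measure.pi_closedBall`); a union bound (`ofReal_one_sub_le_volume_freeVolume`) and Tonelli
(`Measure.prod_apply_symm`) conclude.  The hypothesis `ε ≤ 1/2` of the registered signature is not needed.
-/

open scoped ENNReal
open MeasureTheory Set Metric
open Literature.Analysis.FluidPDE Literature.MathematicalPhysics.KineticTheory

namespace Summit.AtomisticToContinuum.HydrodynamicLimit.Theorems.OLC

noncomputable section

/-! ## One ball of the minimal-image distance is small -/

/-- The `ε`-neighbourhood of a point of `T³` for the minimal-image Euclidean distance lies in the closed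
`ε`-ball of the product (sup) metric: each coordinate of the symmetric representative is bounded by its
Euclidean norm. [folklore] -/
theorem setOf_euclidDist_lt_subset_closedBall_T3 (c : T3) {ε : ℝ} (hε : 0 ≤ ε) :
    {p : T3 | Torus.euclidDist p c < ε} ⊆ closedBall c ε := by
  -- adapted from `Literature.MathematicalPhysics.KineticTheory.setOf_euclidDist_lt_subset_closedBall`
  intro p hp
  rw [mem_closedBall, dist_pi_le_iff hε]
  intro k
  rw [dist_eq_norm, ← Pi.sub_apply, ← Torus.abs_reprSym_apply]
  exact (Torus.abs_reprSym_apply_le_norm _ k).trans (le_of_lt hp)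

/-- A ball of radius `ε ≥ 0` of the minimal-image distance of `T³` has Haar probability at most `(2ε)³`
(it lies in the product of three arcs of length `min 1 (2ε)`, `AddCircle.volume_closedBall`). [folklore] -/
theorem volume_setOf_euclidDist_lt_le_cube (c : T3) {ε : ℝ} (hε : 0 ≤ ε) :
    volume {p : T3 | Torus.euclidDist p c < ε} ≤ ENNReal.ofReal ((2 * ε) ^ 3) := by
  -- adapted from `Literature.MathematicalPhysics.KineticTheory.volume_setOf_euclidDist_lt_le`
  haveI : ∀ _k : Fin 3, SigmaFinite (volume : Measure UnitAddCircle) := fun _ => inferInstance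
  refine (measure_mono (setOf_euclidDist_lt_subset_closedBall_T3 c hε)).trans ?_
  rw [volume_pi, Measure.pi_closedBall (fun _ : Fin 3 => (volume : Measure UnitAddCircle)) c hε]
  simp only [AddCircle.volume_closedBall, Finset.prod_const, Finset.card_univ, Fintype.card_fin]
  rw [ENNReal.ofReal_pow (by positivity)]
  gcongr
  exact min_le_right _ _

/-! ## The free volume of one sphere among hard-core others -/

/-- The free positions for a sphere among the centres `y k`, `k : Fin m`, at scale `ε` — the complement of
the `m` excluded balls — form a measurable set. [folklore] -/
theorem measurableSet_freeVolume_T3 {m : ℕ} (ε : ℝ) (y : Fin m → T3) :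
    MeasurableSet {p : T3 | ∀ k : Fin m, ε ≤ Torus.euclidDist p (y k)} := by
  have h : ∀ k : Fin m, MeasurableSet {p : T3 | ε ≤ Torus.euclidDist p (y k)} := fun k =>
    measurableSet_le measurable_const
      (Torus.continuous_euclidDist.comp (continuous_id.prodMk continuous_const)).measurable
  convert MeasurableSet.iInter h using 1
  ext p
  simp

/-- **The union bound on `T³`** (BGSR Appendix A, first step): the free positions for a sphere among `m`
centres at scale `ε ≥ 0` have Haar probability at least `1 - m (2ε)³`. [folklore] -/
theorem ofReal_one_sub_le_volume_freeVolume {m : ℕ} {ε : ℝ} (hε : 0 ≤ ε) (y : Fin m → T3) :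
    ENNReal.ofReal (1 - m * (2 * ε) ^ 3) ≤ volume {p : T3 | ∀ k : Fin m, ε ≤ Torus.euclidDist p (y k)} := by
  -- adapted from `Literature.MathematicalPhysics.KineticTheory.volume_real_setOf_forall_le_euclidDist_ge`
  set S : Set T3 := {p : T3 | ∀ k : Fin m, ε ≤ Torus.euclidDist p (y k)} with hS
  have hS_meas : MeasurableSet S := measurableSet_freeVolume_T3 ε y
  have hcompl : (volume : Measure T3).real S + (volume : Measure T3).real Sᶜ = 1 := by
    rw [measureReal_add_measureReal_compl hS_meas, probReal_univ]
  have hSc : Sᶜ = ⋃ k : Fin m, {p : T3 | Torus.euclidDist p (y k) < ε} := by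
    ext p
    simp [hS, not_le]
  have hle : (volume : Measure T3).real Sᶜ ≤ m * (2 * ε) ^ 3 := by
    rw [hSc]
    refine (measureReal_iUnion_fintype_le _).trans ?_
    calc ∑ k : Fin m, (volume : Measure T3).real {p : T3 | Torus.euclidDist p (y k) < ε}
        ≤ ∑ _k : Fin m, (2 * ε) ^ 3 := Finset.sum_le_sum fun k _ =>
          ENNReal.toReal_le_of_le_ofReal (by positivity) (volume_setOf_euclidDist_lt_le_cube (y k) hε)
      _ = m * (2 * ε) ^ 3 := by simp
  calc ENNReal.ofReal (1 - m * (2 * ε) ^ 3) ≤ ENNReal.ofReal ((volume : Measure T3).real S) :=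
        ENNReal.ofReal_le_ofReal (by linarith)
    _ = volume S := ofReal_measureReal (measure_ne_top _ _)

/-! ## Splitting off the tagged coordinate -/

/-- Splitting off the coordinate `i` (`MeasurableEquiv.piFinSuccAbove`): the non-overlap event of the particles
other than `i` only constrains the remaining coordinates, which form a configuration of `posDomain ε m`.
[folklore] -/
theorem othersDomain_subset_preimage_piFinSuccAbove {m : ℕ} (ε : ℝ) (i : Fin (m + 1)) :
    {x : Fin (m + 1) → T3 | ∀ k l : Fin (m + 1), k ≠ l → k ≠ i → l ≠ i → ε ≤ Torus.euclidDist (x k) (x l)} ⊆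
      MeasurableEquiv.piFinSuccAbove (fun _ => T3) i ⁻¹' (univ ×ˢ posDomain ε m) := by
  intro x hx
  simp only [mem_preimage, MeasurableEquiv.piFinSuccAbove_apply, Fin.insertNthEquiv_symm_apply, mem_prod,
    mem_univ, true_and, posDomain, mem_setOf_eq]
  intro k l hkl
  exact hx (i.succAbove k) (i.succAbove l) (Fin.succAbove_right_injective.ne hkl) (Fin.succAbove_ne i k)
    (Fin.succAbove_ne i l)

/-- Over a non-overlapping configuration `y` of the others, the fibre of `posDomain` contains the free volume:
inserting at `i` a centre at distance `≥ ε` from every `y k` gives a non-overlapping configuration. [folklore] -/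
theorem insertNth_mem_posDomain {m : ℕ} {ε : ℝ} (i : Fin (m + 1)) {y : Fin m → T3}
    (hy : y ∈ posDomain ε m) {p : T3} (hp : ∀ k : Fin m, ε ≤ Torus.euclidDist p (y k)) :
    Fin.insertNth i p y ∈ posDomain ε (m + 1) := by
  -- adapted from `Literature.MathematicalPhysics.KineticTheory.cons_mem_hardSphereDomain` (the case `i = 0`)
  simp only [posDomain, mem_setOf_eq] at hy ⊢
  intro k l hkl
  rcases eq_or_ne k i with rfl | hk
  · obtain ⟨l', rfl⟩ := Fin.exists_succAbove_eq hkl.symm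
    rw [Fin.insertNth_apply_same, Fin.insertNth_apply_succAbove]
    exact hp l'
  · obtain ⟨k', rfl⟩ := Fin.exists_succAbove_eq hk
    rcases eq_or_ne l i with rfl | hl
    · rw [Fin.insertNth_apply_same, Fin.insertNth_apply_succAbove, Torus.euclidDist_comm]
      exact hp k'
    · obtain ⟨l', rfl⟩ := Fin.exists_succAbove_eq hl
      rw [Fin.insertNth_apply_succAbove, Fin.insertNth_apply_succAbove]
      exact hy k' l' (Fin.succAbove_right_injective.ne_iff.1 hkl)

/-! ## The registered stub -/

/-- **Registered stub `volume_posDomain_ge_othersDomain` (free-volume lower bound for inserting one sphere among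
hard-core others).** For `0 < ε ≤ 1/2` and a label `i`, the non-overlap set of `n` spheres at scale `ε` on `T³`
has volume at least `1 - (n - 1)(2ε)³` times the volume of the event "the spheres other than `i` do not
overlap": `Z_n ≥ (1 - (n - 1)(2ε)³) · Z_others` (fibrewise free volume `≥ 1 - (n - 1)(2ε)³` over every
non-overlapping configuration of the others, integrated by Tonelli). [folklore] -/
theorem volume_posDomain_ge_othersDomain : ∀ {ε : ℝ}, 0 < ε → ε ≤ 2⁻¹ → ∀ {n : ℕ} (i : Fin n), ENNReal.ofReal (1 - ((n : ℝ) - 1) * (2 * ε) ^ 3) * MeasureTheory.volume {x : Fin n → Literature.MathematicalPhysics.KineticTheory.T3 | ∀ k l : Fin n, k ≠ l → k ≠ i → l ≠ i → ε ≤ Literature.Analysis.FluidPDE.Torus.euclidDist (x k) (x l)} ≤ MeasureTheory.volume (Literature.MathematicalPhysics.KineticTheory.posDomain ε n) := by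
  intro ε hε _ n i
  cases n with
  | zero => exact i.elim0
  | succ m =>
  rw [show ((m + 1 : ℕ) : ℝ) - 1 = m by push_cast; ring]
  -- the constant, the others' non-overlap set, the coordinate splitting
  set c : ℝ≥0∞ := ENNReal.ofReal (1 - (m : ℝ) * (2 * ε) ^ 3) with hc_def
  have hD : MeasurableSet (posDomain ε m) := measurableSet_posDomain ε m
  have hA : MeasurableSet (posDomain ε (m + 1)) := measurableSet_posDomain ε (m + 1)
  set e : (Fin (m + 1) → T3) ≃ᵐ T3 × (Fin m → T3) := MeasurableEquiv.piFinSuccAbove (fun _ => T3) i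
    with he_def
  have he : MeasurePreserving e volume volume := volume_preserving_piFinSuccAbove (fun _ => T3) i
  -- the fibrewise free-volume bound over the others' non-overlap set
  have hfib : ∀ y ∈ posDomain ε m,
      c ≤ volume ((fun p : T3 => (p, y)) ⁻¹' (e.symm ⁻¹' posDomain ε (m + 1))) := by
    intro y hy
    refine (ofReal_one_sub_le_volume_freeVolume hε.le y).trans (measure_mono fun p hp => ?_)
    simp only [mem_preimage, he_def, MeasurableEquiv.piFinSuccAbove_symm_apply]
    exact insertNth_mem_posDomain i hy hp
  calc c * volume {x : Fin (m + 1) → T3 |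
          ∀ k l : Fin (m + 1), k ≠ l → k ≠ i → l ≠ i → ε ≤ Torus.euclidDist (x k) (x l)}
      ≤ c * volume (e ⁻¹' (univ ×ˢ posDomain ε m)) :=
        mul_le_mul_right (measure_mono (othersDomain_subset_preimage_piFinSuccAbove ε i)) c
    _ = c * volume (posDomain ε m) := by
        rw [he.measure_preimage_equiv (univ ×ˢ posDomain ε m), Measure.volume_eq_prod, Measure.prod_prod,
          measure_univ, one_mul]
    _ = ∫⁻ _ in posDomain ε m, c := (setLIntegral_const _ c).symm
    _ ≤ ∫⁻ y in posDomain ε m, volume ((fun p : T3 => (p, y)) ⁻¹' (e.symm ⁻¹' posDomain ε (m + 1))) :=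
        setLIntegral_mono' hD hfib
    _ ≤ ∫⁻ y, volume ((fun p : T3 => (p, y)) ⁻¹' (e.symm ⁻¹' posDomain ε (m + 1))) :=
        setLIntegral_le_lintegral _ _
    _ = volume (e.symm ⁻¹' posDomain ε (m + 1)) := by
        rw [Measure.volume_eq_prod, Measure.prod_apply_symm (hA.preimage e.symm.measurable)]
    _ = volume (posDomain ε (m + 1)) := (he.symm e).measure_preimage_equiv _

end

end Summit.AtomisticToContinuum.HydrodynamicLimit.Theorems.OLC
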